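import Summits.RiemannHypothesis.RiemannHypothesis.Theorems.Splittings.SplitXWucK1RG
import HarnessLib

/-!
# Splittings — x-wuc GEN-11 `SplitXWucK1R` (K1′(ℝ) AT THE STAKE) — mechanical carve part 8/14
Continuation of `Summits.RiemannHypothesis.RiemannHypothesis.Theorems.Splittings.SplitXWucK1RG`: byte-identical declaration units of the referee-passed extract `SplitXWucK1R.lean`
sha16 70c8eb2af2868881 (x-wuc g11; ref g10 PASS 2026-08-27T22:59:46Z; RULING #330); open namespaces/sections re-opened with their context.
HONEST LABEL: splitting search over kernel-typed RH-equivalences; K-CERT′ (complex `f`) stays OPEN; nothing here bears on the truth of RH.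
-/
set_option linter.dupNamespace false
noncomputable section
open scoped Classical ComplexConjugate
open Set Filter Topology Complex MeasureTheory
open Real Set Filter Topology
open Real Set MeasureTheory Complex Filter Topology
open scoped Real
namespace Summit.RiemannHypothesis.RiemannHypothesis.Theorems.Splittings.XWucG8.DSLine
open Real Set MeasureTheory Complex Filter Topology
open scoped Real
section inband
set_option maxHeartbeats 1600000 in
/-- **the two-lobe certificate with the density-scaled band.** For real continuous `f`, `D ≥ 1`, `θ ≤ 0.043` and a maximiser `λ*` of the
odd transform with `|λ*| ≤ e^{2πD}/4 − 3/2`: `CertBodyR ε κ₀ D 400 (3/2) θ f` (the proof of `kCertLOn_sAlpha` verbatim with band `Λ_D` and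
the ridge discarded). -/
theorem certBodyR_of_inband_max {ε κ₀ D θ : ℝ} (hε : 0 < ε) (hκ₀ : 0 < κ₀) (hκ₀' : κ₀ < 1 / 2) (hD : 1 ≤ D)
    (hθ : θ ≤ 43 / 1000) {f : ℝ → ℂ} (hfc : Continuous f) (hreal : ∀ u : ℝ, (f u).im = 0) {lamS : ℝ}
    (hlamS : |lamS| ≤ Real.exp (2 * Real.pi * D) / 4 - 3 / 2)
    (hmaxS : ∀ lam : ℝ, ‖tfT (oddPart f) lam 0‖ ≤ ‖tfT (oddPart f) lamS 0‖) :
    CertBodyR ε κ₀ D 400 (3 / 2) θ f := by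
  have hΦ0 : 0 ≤ Phi κ₀ := Phi_nonneg_of_pos hκ₀
  have hRD : 0 ≤ (∫ u in Icc (-1 : ℝ) 1, ‖f u‖ ^ 2) / D :=
    div_nonneg (integral_nonneg fun u => by positivity) (by linarith)
  have hgc : Continuous (oddPart f) := continuous_oddPart hfc
  have hM0 : 0 ≤ ‖tfT (oddPart f) lamS 0‖ := norm_nonneg _
  have hpair : ‖∫ u in Icc (-1 : ℝ) 1, 2 * (Real.sinh (κ₀ * u) : ℂ) * f u‖ ≤
      2 * ‖tfT (oddPart f) lamS 0‖ * Real.sinh κ₀ := by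
    rw [pairing_oddPart hfc]
    exact norm_pairing_le (oddPart f) hgc _ hmaxS hκ₀.le
  have hΛ : 3 ≤ Real.exp (2 * Real.pi * D) / 4 := by
    have h1 := SignConeRung.three_le_Lambda
    have h2 : Real.exp (2 * Real.pi) ≤ Real.exp (2 * Real.pi * D) := by
      apply Real.exp_le_exp.mpr; nlinarith [Real.pi_pos]
    linarith
  have hπlo := Real.pi_gt_d6
  have hπhi := Real.pi_lt_d6
  rcases eq_or_lt_of_le hM0 with hMz | hMpos
  · -- the odd part has identically vanishing transform: empty certificate
    refine ⟨0, Fin.elim0, Fin.elim0, Fin.elim0, fun i => i.elim0, fun lam κ _ _ => by simp, ?_⟩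
    have hX : ‖∫ u in Icc (-1 : ℝ) 1, 2 * (Real.sinh (κ₀ * u) : ℂ) * f u‖ = 0 := by
      apply le_antisymm _ (norm_nonneg _)
      calc ‖∫ u in Icc (-1 : ℝ) 1, 2 * (Real.sinh (κ₀ * u) : ℂ) * f u‖
          ≤ 2 * ‖tfT (oddPart f) lamS 0‖ * Real.sinh κ₀ := hpair
        _ = 0 := by rw [← hMz]; ring
    simp only [Finset.univ_eq_empty, Finset.sum_empty, add_zero]
    rw [hX]
    calc 2 * Real.pi * θ * (0 : ℝ) ^ 2 = 0 := by ring
      _ ≤ (1 + ε) * Phi κ₀ * ((∫ u in Icc (-1 : ℝ) 1, ‖f u‖ ^ 2) / D) :=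
          mul_nonneg (mul_nonneg (by linarith) hΦ0) hRD
  · set M := ‖tfT (oddPart f) lamS 0‖ with hM_def
    have hatS : ‖tfT (oddPart f) lamS 0‖ = M := rfl
    have hatS' : ‖tfT (oddPart f) (-lamS) 0‖ = M := norm_tfT_oddPart_neg hreal lamS 0
    have hfar := maximiser_far (oddPart f) hgc hMpos hmaxS hatS (tfT_oddPart_zero f)
    -- geometry of the two lobes: no window straddles 0 and the two lobes are never active together
    have hgeo : ∀ j : ℕ, j < 16 → ∀ c : ℝ, 27 / 20 < |c| →
        ¬ (c - (π / 2 - yN j) < 0 ∧ 0 ≤ c + (π / 2 - yN j)) := by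
      intro j hj c hc ⟨h1, h2⟩
      obtain ⟨hy1, hy2⟩ := yN_mem j hj
      have : |c| ≤ π / 2 - yN j := abs_le.mpr ⟨by linarith, by linarith⟩
      linarith
    have hfar' : 27 / 20 < |(-lamS)| := by rwa [abs_neg]
    refine ⟨16 + 16, aW lamS, bW lamS, tW M, ?_, ?_, ?_⟩
    · -- window data are admissible
      intro i
      induction i using Fin.addCases with
      | left j =>
          simp only [aW, bW, tW, Fin.append_left]
          obtain ⟨hy1, hy2⟩ := yN_mem j j.isLt
          have habs := abs_le.mp hlamS
          have ht : 0 ≤ M ^ 2 * (sN (j : ℕ) ^ 2 - sN ((j : ℕ) + 1) ^ 2) := by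
            have h1 := sN_succ_le j
            have h2 := sN_nonneg ((j : ℕ) + 1)
            have : sN ((j : ℕ) + 1) ^ 2 ≤ sN (j : ℕ) ^ 2 := pow_le_pow_left₀ h2 h1 2
            exact mul_nonneg (sq_nonneg M) (by linarith)
          exact ⟨by linarith, by linarith, by linarith, by linarith, ht⟩
      | right j =>
          simp only [aW, bW, tW, Fin.append_right]
          obtain ⟨hy1, hy2⟩ := yN_mem j j.isLt
          have habs := abs_le.mp hlamS
          have ht : 0 ≤ M ^ 2 * (sN (j : ℕ) ^ 2 - sN ((j : ℕ) + 1) ^ 2) := by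
            have h1 := sN_succ_le j
            have h2 := sN_nonneg ((j : ℕ) + 1)
            have : sN ((j : ℕ) + 1) ^ 2 ≤ sN (j : ℕ) ^ 2 := pow_le_pow_left₀ h2 h1 2
            exact mul_nonneg (sq_nonneg M) (by linarith)
          exact ⟨by linarith, by linarith, by linarith, by linarith, ht⟩
    · -- the certificate lies below ‖tfT f‖²
      intro lam κ hκ hκ'
      have hdom : ‖tfT (oddPart f) lam κ‖ ^ 2 ≤ ‖tfT f lam κ‖ ^ 2 :=
        pow_le_pow_left₀ (norm_nonneg _) (norm_tfT_oddPart_le hreal hfc lam κ) 2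
      have hA := lobe_levels (oddPart f) hgc hMpos hmaxS hatS (lam := lam) hκ hκ'.le
      have hB := lobe_levels (oddPart f) hgc hMpos hmaxS hatS' (lam := lam) hκ hκ'.le
      rw [Finset.sum_filter, Fin.sum_univ_add]
      simp only [aW, bW, tW, Fin.append_left, Fin.append_right]
      rw [Fin.sum_univ_eq_sum_range (fun j => if lamS - (π / 2 - yN j) < lam ∧ lam ≤ lamS + (π / 2 - yN j)
            then M ^ 2 * (sN j ^ 2 - sN (j + 1) ^ 2) else 0) 16,
          Fin.sum_univ_eq_sum_range (fun j => if -lamS - (π / 2 - yN j) < lam ∧ lam ≤ -lamS + (π / 2 - yN j)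
            then M ^ 2 * (sN j ^ 2 - sN (j + 1) ^ 2) else 0) 16]
      rw [Finset.sum_filter] at hA hB
      by_cases hact : ∃ j, j < 16 ∧ (lamS - (π / 2 - yN j) < lam ∧ lam ≤ lamS + (π / 2 - yN j))
      · -- lobe at lamS active ⇒ lobe at −lamS silent
        obtain ⟨j₁, hj₁, hc1, hc2⟩ := hact
        obtain ⟨hy1, hy2⟩ := yN_mem j₁ hj₁
        have hBz : (∑ j ∈ Finset.range 16, if -lamS - (π / 2 - yN j) < lam ∧ lam ≤ -lamS + (π / 2 - yN j)
            then M ^ 2 * (sN j ^ 2 - sN (j + 1) ^ 2) else 0) = 0 := by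
          apply Finset.sum_eq_zero
          intro j hj
          rw [if_neg]
          rintro ⟨h1, h2⟩
          obtain ⟨hy1', hy2'⟩ := yN_mem j (Finset.mem_range.mp hj)
          have : |lamS| ≤ 27 / 20 := abs_le.mpr ⟨by linarith, by linarith⟩
          linarith
        rw [hBz, add_zero]
        exact hA.trans hdom
      · have hAz : (∑ j ∈ Finset.range 16, if lamS - (π / 2 - yN j) < lam ∧ lam ≤ lamS + (π / 2 - yN j)
            then M ^ 2 * (sN j ^ 2 - sN (j + 1) ^ 2) else 0) = 0 := by
          apply Finset.sum_eq_zero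
          intro j hj
          rw [if_neg]
          intro h
          exact hact ⟨j, Finset.mem_range.mp hj, h⟩
        rw [hAz, zero_add]
        exact hB.trans hdom
    · -- the credit inequality
      rw [Fin.sum_univ_add]
      simp only [aW, bW, tW, Fin.append_left, Fin.append_right]
      rw [Fin.sum_univ_eq_sum_range (fun j => M ^ 2 * (sN j ^ 2 - sN (j + 1) ^ 2) *
            (lamS + (π / 2 - yN j) - (lamS - (π / 2 - yN j)) - 3 / 2 -
              if lamS - (π / 2 - yN j) < 0 ∧ 0 ≤ lamS + (π / 2 - yN j) then 3 / 2 else 0)) 16,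
          Fin.sum_univ_eq_sum_range (fun j => M ^ 2 * (sN j ^ 2 - sN (j + 1) ^ 2) *
            (-lamS + (π / 2 - yN j) - (-lamS - (π / 2 - yN j)) - 3 / 2 -
              if -lamS - (π / 2 - yN j) < 0 ∧ 0 ≤ -lamS + (π / 2 - yN j) then 3 / 2 else 0)) 16]
      have hcredA : M ^ 2 * (571 / 2500) ≤ ∑ j ∈ Finset.range 16, M ^ 2 * (sN j ^ 2 - sN (j + 1) ^ 2) *
            (lamS + (π / 2 - yN j) - (lamS - (π / 2 - yN j)) - 3 / 2 -
              if lamS - (π / 2 - yN j) < 0 ∧ 0 ≤ lamS + (π / 2 - yN j) then 3 / 2 else 0) := by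
        have h := credit16
        calc M ^ 2 * (571 / 2500) ≤ M ^ 2 * ∑ j ∈ Finset.range 16,
              (sN j ^ 2 - sN (j + 1) ^ 2) * (1641592 / 1000000 - 2 * yN j) :=
              mul_le_mul_of_nonneg_left h (sq_nonneg M)
          _ = ∑ j ∈ Finset.range 16, M ^ 2 * ((sN j ^ 2 - sN (j + 1) ^ 2) * (1641592 / 1000000 - 2 * yN j)) := by
              rw [Finset.mul_sum]
          _ ≤ _ := by
              apply Finset.sum_le_sum
              intro j hj
              have hj16 := Finset.mem_range.mp hj
              rw [if_neg (hgeo j hj16 lamS hfar)]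
              have ht : 0 ≤ sN j ^ 2 - sN (j + 1) ^ 2 := by
                have h1 := sN_succ_le j
                have h2 := sN_nonneg (j + 1)
                have : sN (j + 1) ^ 2 ≤ sN j ^ 2 := pow_le_pow_left₀ h2 h1 2
                linarith
              have hM2 : 0 ≤ M ^ 2 := sq_nonneg M
              have hlen : 1641592 / 1000000 - 2 * yN j ≤
                  lamS + (π / 2 - yN j) - (lamS - (π / 2 - yN j)) - 3 / 2 - 0 := by linarith
              calc M ^ 2 * ((sN j ^ 2 - sN (j + 1) ^ 2) * (1641592 / 1000000 - 2 * yN j))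
                  = (M ^ 2 * (sN j ^ 2 - sN (j + 1) ^ 2)) * (1641592 / 1000000 - 2 * yN j) := by ring
                _ ≤ (M ^ 2 * (sN j ^ 2 - sN (j + 1) ^ 2)) *
                    (lamS + (π / 2 - yN j) - (lamS - (π / 2 - yN j)) - 3 / 2 - 0) :=
                    mul_le_mul_of_nonneg_left hlen (mul_nonneg hM2 ht)
      have hcredB : M ^ 2 * (571 / 2500) ≤ ∑ j ∈ Finset.range 16, M ^ 2 * (sN j ^ 2 - sN (j + 1) ^ 2) *
            (-lamS + (π / 2 - yN j) - (-lamS - (π / 2 - yN j)) - 3 / 2 -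
              if -lamS - (π / 2 - yN j) < 0 ∧ 0 ≤ -lamS + (π / 2 - yN j) then 3 / 2 else 0) := by
        have h := credit16
        calc M ^ 2 * (571 / 2500) ≤ M ^ 2 * ∑ j ∈ Finset.range 16,
              (sN j ^ 2 - sN (j + 1) ^ 2) * (1641592 / 1000000 - 2 * yN j) :=
              mul_le_mul_of_nonneg_left h (sq_nonneg M)
          _ = ∑ j ∈ Finset.range 16, M ^ 2 * ((sN j ^ 2 - sN (j + 1) ^ 2) * (1641592 / 1000000 - 2 * yN j)) := by
              rw [Finset.mul_sum]
          _ ≤ _ := by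
              apply Finset.sum_le_sum
              intro j hj
              have hj16 := Finset.mem_range.mp hj
              rw [if_neg (hgeo j hj16 (-lamS) hfar')]
              have ht : 0 ≤ sN j ^ 2 - sN (j + 1) ^ 2 := by
                have h1 := sN_succ_le j
                have h2 := sN_nonneg (j + 1)
                have : sN (j + 1) ^ 2 ≤ sN j ^ 2 := pow_le_pow_left₀ h2 h1 2
                linarith
              have hM2 : 0 ≤ M ^ 2 := sq_nonneg M
              have hlen : 1641592 / 1000000 - 2 * yN j ≤
                  -lamS + (π / 2 - yN j) - (-lamS - (π / 2 - yN j)) - 3 / 2 - 0 := by linarith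
              calc M ^ 2 * ((sN j ^ 2 - sN (j + 1) ^ 2) * (1641592 / 1000000 - 2 * yN j))
                  = (M ^ 2 * (sN j ^ 2 - sN (j + 1) ^ 2)) * (1641592 / 1000000 - 2 * yN j) := by ring
                _ ≤ (M ^ 2 * (sN j ^ 2 - sN (j + 1) ^ 2)) *
                    (-lamS + (π / 2 - yN j) - (-lamS - (π / 2 - yN j)) - 3 / 2 - 0) :=
                    mul_le_mul_of_nonneg_left hlen (mul_nonneg hM2 ht)
      -- the arithmetic: 2π θ X² ≤ (1+ε) Φ · credit
      set CR := (∑ j ∈ Finset.range 16, M ^ 2 * (sN j ^ 2 - sN (j + 1) ^ 2) *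
            (lamS + (π / 2 - yN j) - (lamS - (π / 2 - yN j)) - 3 / 2 -
              if lamS - (π / 2 - yN j) < 0 ∧ 0 ≤ lamS + (π / 2 - yN j) then 3 / 2 else 0)) +
          ∑ j ∈ Finset.range 16, M ^ 2 * (sN j ^ 2 - sN (j + 1) ^ 2) *
            (-lamS + (π / 2 - yN j) - (-lamS - (π / 2 - yN j)) - 3 / 2 -
              if -lamS - (π / 2 - yN j) < 0 ∧ 0 ≤ -lamS + (π / 2 - yN j) then 3 / 2 else 0) with hCR
      have hCR2 : 2 * (M ^ 2 * (571 / 2500)) ≤ CR := by rw [hCR]; linarith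
      have hsinh := SignConeRung.sinh_le_of_le_half hκ₀.le hκ₀'.le
      have hΦ := SignConeRung.Phi_lower hκ₀
      have hΦ0 : 0 ≤ Phi κ₀ := le_trans (by positivity) hΦ
      set X := ‖∫ u in Icc (-1 : ℝ) 1, 2 * (Real.sinh (κ₀ * u) : ℂ) * f u‖ with hX_def
      have hX0 : 0 ≤ X := norm_nonneg _
      have hX : X ≤ 2.0844 * κ₀ * M := by
        calc X ≤ 2 * M * Real.sinh κ₀ := hpair
          _ ≤ 2 * M * (2 * κ₀ * 0.5211) := by gcongr
          _ = 2.0844 * κ₀ * M := by ring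
      have hX2 : X ^ 2 ≤ (2.0844 * κ₀ * M) ^ 2 := pow_le_pow_left₀ hX0 hX 2
      have hkm : 0 ≤ (κ₀ * M) ^ 2 := sq_nonneg _
      have hCR0 : 0 ≤ CR := le_trans (by positivity) hCR2
      have hθ' : 2 * Real.pi * θ ≤ 2 * Real.pi * (43 / 1000) := mul_le_mul_of_nonneg_left hθ (by positivity)
      calc 2 * Real.pi * θ * X ^ 2 ≤ 2 * Real.pi * (43 / 1000) * X ^ 2 := mul_le_mul_of_nonneg_right hθ' (sq_nonneg X)
        _ ≤ 2 * 3.141593 * (43 / 1000) * (2.0844 * κ₀ * M) ^ 2 := by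
            gcongr
        _ ≤ 1 * (8 / 3 * κ₀ ^ 2) * (2 * (M ^ 2 * (571 / 2500))) := by nlinarith
        _ ≤ (1 + ε) * Phi κ₀ * CR := by gcongr; linarith
        _ ≤ (1 + ε) * Phi κ₀ * ((∫ u in Icc (-1 : ℝ) 1, ‖f u‖ ^ 2) / D + CR) := by
            have h0 : 0 ≤ (1 + ε) * Phi κ₀ := mul_nonneg (by linarith) hΦ0
            nlinarith

/-- clamp the argument to `[−1,1]`. -/
noncomputable def clampF (f : ℝ → ℂ) : ℝ → ℂ := fun u => f (max (-1) (min 1 u))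

/-- `clampF_mem` — helper of the x-wuc GEN-11 chain «K1′(ℝ) at the stake» (verbatim from the referee-passed extract `SplitXWucK1R.lean` 70c8eb2af2868881; role: see the module docstring). -/
theorem clampF_mem (u : ℝ) : max (-1 : ℝ) (min 1 u) ∈ Icc (-1 : ℝ) 1 :=
  ⟨le_max_left _ _, max_le (by norm_num) (min_le_left _ _)⟩

/-- `clampF_eq` — helper of the x-wuc GEN-11 chain «K1′(ℝ) at the stake» (verbatim from the referee-passed extract `SplitXWucK1R.lean` 70c8eb2af2868881; role: see the module docstring). -/
theorem clampF_eq (f : ℝ → ℂ) {u : ℝ} (hu : u ∈ Icc (-1 : ℝ) 1) : clampF f u = f u := by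
  simp only [clampF, min_eq_right hu.2, max_eq_right hu.1]

/-- `continuous_clampF` — helper of the x-wuc GEN-11 chain «K1′(ℝ) at the stake» (verbatim from the referee-passed extract `SplitXWucK1R.lean` 70c8eb2af2868881; role: see the module docstring). -/
theorem continuous_clampF {f : ℝ → ℂ} (hfc : Continuous f) : Continuous (clampF f) :=
  hfc.comp (continuous_const.max (continuous_const.min continuous_id))

/-- `clampF_im` — helper of the x-wuc GEN-11 chain «K1′(ℝ) at the stake» (verbatim from the referee-passed extract `SplitXWucK1R.lean` 70c8eb2af2868881; role: see the module docstring). -/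
theorem clampF_im {f : ℝ → ℂ} (hf : f ∈ RealVal) (u : ℝ) : (clampF f u).im = 0 := hf _ (clampF_mem u)

/-- `tfT_congr_Icc` — helper of the x-wuc GEN-11 chain «K1′(ℝ) at the stake» (verbatim from the referee-passed extract `SplitXWucK1R.lean` 70c8eb2af2868881; role: see the module docstring). -/
theorem tfT_congr_Icc {f g : ℝ → ℂ} (hfg : ∀ u ∈ Icc (-1 : ℝ) 1, f u = g u) (lam κ : ℝ) : tfT f lam κ = tfT g lam κ :=
  setIntegral_congr_fun measurableSet_Icc (fun u hu => by rw [hfg u hu])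

/-- `tfT_oddPart_clampF` — helper of the x-wuc GEN-11 chain «K1′(ℝ) at the stake» (verbatim from the referee-passed extract `SplitXWucK1R.lean` 70c8eb2af2868881; role: see the module docstring). -/
theorem tfT_oddPart_clampF (f : ℝ → ℂ) (lam κ : ℝ) : tfT (oddPart (clampF f)) lam κ = tfT (oddPart f) lam κ := by
  apply tfT_congr_Icc
  intro u hu
  have hu' : -u ∈ Icc (-1 : ℝ) 1 := ⟨by linarith [hu.2], by linarith [hu.1]⟩
  simp only [oddPart, clampF_eq f hu, clampF_eq f hu']

/-- `CertBodyR` only sees `f` on `[−1,1]`. -/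
theorem certBodyR_congr_Icc {ε κ₀ D Lc δ θ : ℝ} {f g : ℝ → ℂ} (hfg : ∀ u ∈ Icc (-1 : ℝ) 1, f u = g u)
    (h : CertBodyR ε κ₀ D Lc δ θ g) : CertBodyR ε κ₀ D Lc δ θ f := by
  obtain ⟨m, a, b, t, hw, hc, hcr⟩ := h
  have e2 : (∫ u in Icc (-1 : ℝ) 1, 2 * (Real.sinh (κ₀ * u) : ℂ) * f u)
      = ∫ u in Icc (-1 : ℝ) 1, 2 * (Real.sinh (κ₀ * u) : ℂ) * g u :=
    setIntegral_congr_fun measurableSet_Icc (fun u hu => by rw [hfg u hu])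
  have e3 : (∫ u in Icc (-1 : ℝ) 1, ‖f u‖ ^ 2) = ∫ u in Icc (-1 : ℝ) 1, ‖g u‖ ^ 2 :=
    setIntegral_congr_fun measurableSet_Icc (fun u hu => by rw [hfg u hu])
  refine ⟨m, a, b, t, hw, fun lam κ h1 h2 => ?_, ?_⟩
  · rw [tfT_congr_Icc hfg]; exact hc lam κ h1 h2
  · rw [e2, e3]; exact hcr

/-- **THE EXACT RESIDUAL of K1′(ℝ)** at `(400, 3/2, θ)`: only densities `2πθD > 1`, only `f` real on `[−1,1]`, and only those `(f, D)` for
which NO global maximiser of the odd transform lies in the band `|λ| ≤ e^{2πD}/4 − 3/2` (every in-band value is strictly exceeded). -/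
def KCertFarResidual (θ : ℝ) : Prop :=
  ∀ ε : ℝ, 0 < ε → ∀ κ₀ : ℝ, 0 < κ₀ → κ₀ < 1 / 2 → ∀ D : ℝ, 1 ≤ D → 1 < 2 * Real.pi * θ * D →
    ∀ f : ℝ → ℂ, f ∈ RealVal → Continuous f →
      (∀ lamS : ℝ, |lamS| ≤ Real.exp (2 * Real.pi * D) / 4 - 3 / 2 →
        ∃ lam : ℝ, ‖tfT (oddPart f) lamS 0‖ < ‖tfT (oddPart f) lam 0‖) →
      CertBodyR ε κ₀ D 400 (3 / 2) θ f

/-- **K1′(ℝ) ⟺ its far-peak residual** (`0 ≤ θ ≤ 0.043`). -/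
theorem kCertLROn_realVal_iff_residual {θ : ℝ} (hθ0 : 0 ≤ θ) (hθ : θ ≤ 43 / 1000) :
    KCertLROn RealVal 400 (3 / 2) θ ↔ KCertFarResidual θ := by
  refine ⟨fun h ε hε κ₀ hκ₀ hκ₀' D hD _ f hf hfc _ => h ε hε κ₀ hκ₀ hκ₀' D hD f hf hfc, fun h => ?_⟩
  intro ε hε κ₀ hκ₀ hκ₀' D hD f hf hfc
  by_cases hsmall : 2 * Real.pi * θ * D ≤ 1
  · exact certBodyR_of_small_density hε.le hκ₀ (by linarith) hθ0 hsmall f hfc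
  · have hlarge : 1 < 2 * Real.pi * θ * D := not_le.mp hsmall
    by_cases hin : ∃ lamS : ℝ, |lamS| ≤ Real.exp (2 * Real.pi * D) / 4 - 3 / 2 ∧
        ∀ lam : ℝ, ‖tfT (oddPart f) lam 0‖ ≤ ‖tfT (oddPart f) lamS 0‖
    · obtain ⟨lamS, hlamS, hmax⟩ := hin
      have hmax' : ∀ lam : ℝ, ‖tfT (oddPart (clampF f)) lam 0‖ ≤ ‖tfT (oddPart (clampF f)) lamS 0‖ := by
        intro lam; rw [tfT_oddPart_clampF, tfT_oddPart_clampF]; exact hmax lam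
      exact certBodyR_congr_Icc (fun u hu => (clampF_eq f hu).symm)
        (certBodyR_of_inband_max hε hκ₀ hκ₀' hD hθ (continuous_clampF hfc) (clampF_im hf) hlamS hmax')
    · refine h ε hε κ₀ hκ₀ hκ₀' D hD hlarge f hf hfc fun lamS hl => ?_
      by_contra hno
      exact hin ⟨lamS, hl, fun lam => not_lt.mp fun hlt => hno ⟨lam, hlt⟩⟩

end inband
end Summit.RiemannHypothesis.RiemannHypothesis.Theorems.Splittings.XWucG8.DSLine
namespace Summit.RiemannHypothesis.RiemannHypothesis.Theorems.Splittings.XWucG8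
end Summit.RiemannHypothesis.RiemannHypothesis.Theorems.Splittings.XWucG8
open Real Set MeasureTheory Complex Filter Topology
open scoped Real
namespace Summit.RiemannHypothesis.RiemannHypothesis.Theorems.Splittings.XWucG8
namespace DSLine
section localengine
variable [hT : Fact ((0 : ℝ) < 2)]
/-- **LOCAL ENGINE bound.** `‖∫ f K e^{ix·}‖ ≤ (Σ_{n∈S}‖ĉ_n‖)·Mloc + (Σ'‖ĉ_n‖ − Σ_{n∈S}‖ĉ_n‖)·M` whenever the samples `T(x + πn)`,
`n ∈ S`, are bounded by `Mloc` and all samples by `M`. -/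
theorem norm_engine_le_local (K : ℝ → ℂ) (hK : Continuous K) (hper : K (-1) = K 1)
    (hsum : Summable (fun n : ℤ => ‖fourierCoeff (⇑(kerLift K hK hper) : AddCircle (2:ℝ) → ℂ) n‖))
    (f : ℝ → ℂ) (hf : Continuous f) (x : ℝ) (S : Finset ℤ) {Mloc M : ℝ}
    (hloc : ∀ n ∈ S, ‖tfT f (x + π * n) 0‖ ≤ Mloc) (hM : ∀ y : ℝ, ‖tfT f y 0‖ ≤ M) :
    ‖∫ u in (-1 : ℝ)..1, f u * K u * cexp (I * (x : ℂ) * u)‖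
      ≤ (∑ n ∈ S, ‖fourierCoeff (⇑(kerLift K hK hper) : AddCircle (2:ℝ) → ℂ) n‖) * Mloc +
        ((∑' n : ℤ, ‖fourierCoeff (⇑(kerLift K hK hper) : AddCircle (2:ℝ) → ℂ) n‖) -
          ∑ n ∈ S, ‖fourierCoeff (⇑(kerLift K hK hper) : AddCircle (2:ℝ) → ℂ) n‖) * M := by
  set c : ℤ → ℝ := fun n => ‖fourierCoeff (⇑(kerLift K hK hper) : AddCircle (2:ℝ) → ℂ) n‖ with hc_def
  have hc0 : ∀ n, 0 ≤ c n := fun n => norm_nonneg _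
  have hs := hasSum_engine K hK hper hsum f hf x
  rw [← hs.tsum_eq]
  -- the pointwise majorant
  set b : ℤ → ℝ := fun n => if n ∈ S then c n * Mloc else c n * M with hb_def
  have hle : ∀ n : ℤ, ‖fourierCoeff (⇑(kerLift K hK hper) : AddCircle (2:ℝ) → ℂ) n * tfT f (x + π * n) 0‖ ≤ b n := by
    intro n
    rw [norm_mul]
    by_cases hn : n ∈ S
    · simp only [hb_def, if_pos hn]; exact mul_le_mul_of_nonneg_left (hloc n hn) (norm_nonneg _)
    · simp only [hb_def, if_neg hn]; exact mul_le_mul_of_nonneg_left (hM _) (norm_nonneg _)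
  have hbabs : ∀ n : ℤ, ‖b n‖ ≤ c n * (|Mloc| + |M|) := by
    intro n
    by_cases hn : n ∈ S
    · simp only [hb_def, if_pos hn, Real.norm_eq_abs, abs_mul, abs_of_nonneg (hc0 n)]
      nlinarith [hc0 n, abs_nonneg M, le_abs_self Mloc, neg_abs_le Mloc]
    · simp only [hb_def, if_neg hn, Real.norm_eq_abs, abs_mul, abs_of_nonneg (hc0 n)]
      nlinarith [hc0 n, abs_nonneg Mloc, le_abs_self M, neg_abs_le M]
  have hbsum : Summable b := Summable.of_norm_bounded (hsum.mul_right (|Mloc| + |M|)) hbabs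
  have hsumm : Summable (fun n : ℤ =>
      ‖fourierCoeff (⇑(kerLift K hK hper) : AddCircle (2:ℝ) → ℂ) n * tfT f (x + π * n) 0‖) :=
    Summable.of_nonneg_of_le (fun n => norm_nonneg _) hle hbsum
  -- evaluate `Σ' b` by splitting off `S`
  have hsplit_b := hbsum.sum_add_tsum_compl (s := S)
  have hsplit_c := hsum.sum_add_tsum_compl (s := S)
  have hbS : ∑ n ∈ S, b n = (∑ n ∈ S, c n) * Mloc := by
    rw [Finset.sum_mul]
    exact Finset.sum_congr rfl (fun n hn => by simp only [hb_def, if_pos hn])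
  have hbC : ∑' n : ↑((S : Set ℤ)ᶜ), b n = (∑' n : ↑((S : Set ℤ)ᶜ), c n) * M := by
    rw [← tsum_mul_right]
    exact tsum_congr (fun n => by
      have hn : (n : ℤ) ∉ S := fun h => n.2 h
      simp only [hb_def, if_neg hn])
  have hval : ∑' n : ℤ, b n = (∑ n ∈ S, c n) * Mloc + ((∑' n : ℤ, c n) - ∑ n ∈ S, c n) * M := by
    rw [← hsplit_b, hbS, hbC, ← hsplit_c]
    ring
  calc ‖∑' n : ℤ, fourierCoeff (⇑(kerLift K hK hper) : AddCircle (2:ℝ) → ℂ) n * tfT f (x + π * n) 0‖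
      ≤ ∑' n : ℤ, ‖fourierCoeff (⇑(kerLift K hK hper) : AddCircle (2:ℝ) → ℂ) n * tfT f (x + π * n) 0‖ :=
        norm_tsum_le_tsum_norm hsumm
    _ ≤ ∑' n : ℤ, b n := Summable.tsum_le_tsum hle hsumm hbsum
    _ = _ := hval

end localengine
section localds
/-- the DS coefficient mass carried by the samples within distance `R` of the evaluation point:
`Σ_{n : |πn − (ω + π/2)| ≤ R} ‖dsCoeff ω n‖` (the full mass is `1`, `hasSum_norm_dsCoeff`). -/
noncomputable def dsTrunc (ω R : ℝ) : ℝ :=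
  ∑ n ∈ Finset.Icc ⌈(ω + π / 2 - R) / π⌉ ⌊(ω + π / 2 + R) / π⌋, ‖(dsCoeff ω n : ℂ)‖

/-- `mem_dsTrunc_index` — helper of the x-wuc GEN-11 chain «K1′(ℝ) at the stake» (verbatim from the referee-passed extract `SplitXWucK1R.lean` 70c8eb2af2868881; role: see the module docstring). -/
theorem mem_dsTrunc_index {ω R : ℝ} {n : ℤ} (hn : n ∈ Finset.Icc ⌈(ω + π / 2 - R) / π⌉ ⌊(ω + π / 2 + R) / π⌋) :
    |π * n - (ω + π / 2)| ≤ R := by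
  rw [Finset.mem_Icc] at hn
  have h1 : (ω + π / 2 - R) / π ≤ n := Int.ceil_le.mp hn.1
  have h2 : (n : ℝ) ≤ (ω + π / 2 + R) / π := Int.le_floor.mp hn.2
  rw [div_le_iff₀ Real.pi_pos] at h1
  rw [le_div_iff₀ Real.pi_pos] at h2
  rw [abs_le]; constructor <;> linarith [mul_comm (n : ℝ) π]

end localds
end DSLine
end Summit.RiemannHypothesis.RiemannHypothesis.Theorems.Splittings.XWucG8
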